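import Summits.AtomisticToContinuum.BoseEinsteinCondensation.Theses.BECInsertionCorrector

/-!
# Route `BECInsertionCorrector`, assembly item `Assembly` (stmt-AtomisticToContinuum-12062)

Settles the assembly item `stmt-AtomisticToContinuum-12062` of route
`route-AtomisticToContinuum-BECInsertionCorrector`: the implication
`StaticResponseBound → CorrectorClosure → ResidueCondenses → BoundaryTransferWeak →
BoseEinsteinCondensation` (the sub-problem statement, by name).

The hypotheses of `Assembly` are, verbatim and in the same order, those of the route's deciding
theorem `closes`, so the assembly is that theorem curried; the composition is spelled out again
below for the record: `CorrectorClosure` turns `StaticResponseBound` into `InsertionResidue`,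
`ResidueCondenses` turns that into torus BEC of near-minimisers for every repulsive finite-range
`v` (the `PeriodicBEC` signature), and `BoundaryTransferWeak`, applied per potential, yields
`HasGroundStateBEC v ρ` for `0 < ρ < ρ₀(v)`, i.e. `_root_.BoseEinsteinCondensation`.
Pure logic; no analytic content lives here.

References: [LSSY2005, §1.2 (1.16)–(1.19)] (the conjunct), [PenroseOnsager1956] (criterion).
-/

namespace Summit.AtomisticToContinuum.BoseEinsteinCondensation.Theorems

/-- **Item stmt-AtomisticToContinuum-12062** (`Assembly` of route `BECInsertionCorrector`, exact
signature): the four hypotheses of the route's deciding theorem imply the sub-problem statement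
`BoseEinsteinCondensation`. Proof: for a repulsive finite-range `v`, `BoundaryTransferWeak v`
applied to the torus BEC of near-minimisers that `ResidueCondenses` extracts from the insertion
residue `CorrectorClosure StaticResponseBound`. [folklore] -/
theorem Assembly_proof :
    Summit.AtomisticToContinuum.BoseEinsteinCondensation.Theses.BECInsertionCorrector.Assembly := by
  unfold Theses.BECInsertionCorrector.Assembly
  intro h₁ h₂ h₃ h₄ v hv
  exact h₄ v hv (h₃ (h₂ h₁) v hv)

end Summit.AtomisticToContinuum.BoseEinsteinCondensation.Theorems
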